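import Summits.QuantumAdvantage.AdviceFreeQNC0.AffBells26MoveSystems
import Summits.QuantumAdvantage.AdviceFreeQNC0.AffBells22KernelZeros
import HarnessLib

/-!
# AffBells33 (planner qa-qnc0-p2 g33) — line L3 «walk along the sausage»: the STAIRCASE model case, typed

Cell qa-qnc0, route DWalkThree, crux stmt-QuantumAdvantage-22907, working rung (NP₁) `AffBells26.AffBellsPolyLoss3`.
ROUND-34 §12.12 (planner p1 g35) isolates the last box of the p = 3 architecture: TIGHT SAUSAGES, model case = the STAIRCASE
`β_k = σ·1_{[0,k]}` (prefix counters; position ≈-classes of consecutive rows differ in one position, every coin is straddled by a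
consecutive pair).  This file TYPES the model-case theorem and PROVES the two finite contraction lemmas of its proof
(`HOME/qa-qnc0-p2/line33/PROOF-STAIR.md`, numerics K-91).  Statements are marked; nothing here is a crux.

THE MECHANISM (PROOF-STAIR.md §2).  On the fibre of a kernel line `J` (coins = zeros of `J`, forced bits `x_k = J_{k−1} ⊕ J_{k+1}`,
`Fib19.apply_eq_of_kline`, `Fib19.card_fibre`), the prefix sums `S_k = Σ_{i ≤ k} σ_i x_i (mod 3)` form a LAZY RANDOM WALK on `ℤ₃`
driven by the coins, and the test of active row `k` is the EMISSION `[S_k ≡ c_k]`.  By `AffBells26.targetFormula` the strategy wins iff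
the number of firing active rows has the parity `t_J = N + Z(J) + pairs2(J)`.  Hence `P(win | J) − ½ = ½(−1)^{t_J}(b₀(J) + s_J·b₁(J))`
with the UNTWISTED / TWISTED biases `b₀ = 𝟙ᵀ·Π_k A_k·e₀`, `b₁ = 𝟙ᵀ·Π_k A⁻_k·e₀` (coin ↦ `P_σ = (I + S^σ)/2`, resp.
`P⁻_σ = (I − S^σ)/2`; active row ↦ shift-then-sign `diag((−1)^{[h ≡ c_k]})`, i.e. a REFLECTION `R_r = I − 2E_r` up to sign; `s_J = ±1`
the coin-parity sign of the odd class).  Two finite facts then give exponential decay: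
* `threePairContractionZ` (LEMMA C): any three (coin-block, reflection) pairs HALVE the `ℓ¹` norm — checked here on the vertices
  `(S^a + S^b)/2` of the convex class of coin blocks (circulant, stochastic, coefficients `≤ ½`); trilinearity extends it (PROOF-STAIR §3);
* `twistedTwoCoinContractionZ` (LEMMA C⁻): from a mean-zero state, any two twisted coins (reflections interleaved ad lib) contract
  `ℓ¹` by `3/4`; so `|b₁(J)| ≤ (4/3)(√3/2)^{Z(J)}` — summable by the tree's `AffBells22.kernelZerosMGF` (weight exactly `√3/2` per coin).
An ISOLATED one of `J` (factor `010`; their number is `pairs2 J`) is a block of length 1 whose emission `[h ≡ c_k]` is a reflection for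
EVERY `c` (longer blocks can be silenced by the adversary's residues), so `|b₀(J)| ≤ (1/2)^{⌊(pairs2 J − 1)/3⌋}`, summable by the pairs2
moment bound `KernelPairs2MGF` below (statement; 3-state transfer matrix `E₁₁' = E₁₁+E₀₁, E₁₀' = 2E₁₁+2λE₀₁, E₀₁' = E₁₀`, spectral
radius = largest root of `(1−μ)(μ²−2λ)+2`, `≈ 1.93 < 2` at `λ = 2^{−1/3}`; cf. `Literature…HardCorePairsAtDistanceTwo` for the signed case).

NUMERICS (K-91, exact, `HOME/qa-qnc0-p2/line33/stair*.py`): `max_c` win fraction of the staircase (`σ ≡ 1`), `N = 5,7,9,11,13`: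
`13/16, 45/64, 152/256, 579/1024, 2266/4096` (optimum `c ≡ 0` from `N = 11` on); `c ≡ 0` by a 75-state transfer matrix up to
`N = 257`: excess `≈ C·0.8806^N` (`5.3e−2, 2.5e−2, 8.9e−3, 1.1e−3, 5.2e−5, 1.5e−8` at `N = 13, 17, 25, 41, 65, 129`).
Ported to the tree verbatim (split into three files `AffBells33StairOps` §1–§3 / `AffBells33StairContraction` §4–§5 /
`AffBells33StairChains` §6 for the 400-line rule) by the prover seat qn-prover-3 g20 (landing ask of qa-qnc0-p2 g33, 11:0xZ);
authored and kernel-checked by the planner seat qa-qnc0-p2 g33 (`HOME/qa-qnc0-p2/line33/Sketch33.lean`, 672 l., rc 0 / 0 sorry).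
-/

namespace Summit.QuantumAdvantage.AdviceFreeQNC0

open Finset Literature.Computability.QuantumComplexity Literature.Computability.QuantumComplexity.RingHLF

namespace AffBells33

/-! ## 1. The staircase strategies and the model-case theorem (statements) -/

/-- The staircase with spine `σ`: row `k` tests the prefix sum `Σ_{i ≤ k} σ_i x_i`. -/
def stair {N : ℕ} (σ : Fin N → ZMod 3) : Fin N → Fin N → ZMod 3 := fun k i => if i ≤ k then σ i else 0

/-- **THEOREM S (statement; PROOF-STAIR.md): staircases win at most `(½ + C·κ^N)·2^{N−1}` odd inputs**, uniformly in the
nowhere-zero spine `σ` and the residues `c` (conjugation signs are absorbed in `c`). -/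
def StaircaseLoss3 : Prop :=
  ∃ κ : ℝ, 0 ≤ κ ∧ κ < 1 ∧ ∃ C : ℝ, 0 ≤ C ∧ ∀ N : ℕ, 3 ≤ N → ∀ σ : Fin N → ZMod 3, (∀ i, σ i ≠ 0) →
    ∀ c : Fin N → ZMod 3, (AffBells23.affWinCard (stair σ) c : ℝ) ≤ (1 / 2 + C * κ ^ N) * (2 : ℝ) ^ (N - 1)

/-- The form consumed by (NP₁) `AffBells26.AffBellsPolyLoss3` restricted to staircases: a loss of `2^{N-1}/N^e`. -/
def StaircasePolyLoss3 : Prop :=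
  ∃ e n₀ : ℕ, ∀ N ≥ n₀, ∀ σ : Fin N → ZMod 3, (∀ i, σ i ≠ 0) → ∀ c : Fin N → ZMod 3,
    (AffBells23.affWinCard (stair σ) c : ℝ) ≤ (1 - 1 / (N : ℝ) ^ e) * (2 : ℝ) ^ (N - 1)

/-- Glue (proved): the exponential form implies the polynomial-loss form (`e = 1`). -/
theorem staircasePolyLoss3_of (h : StaircaseLoss3) : StaircasePolyLoss3 := by
  obtain ⟨κ, hκ0, hκ1, C, hC, hS⟩ := h
  have hlim : Filter.Tendsto (fun N : ℕ => C * ((N : ℝ) * κ ^ N)) Filter.atTop (nhds (C * 0)) :=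
    (tendsto_self_mul_const_pow_of_lt_one hκ0 hκ1).const_mul C
  rw [mul_zero] at hlim
  obtain ⟨n₁, hn₁⟩ := Filter.eventually_atTop.mp (hlim.eventually (gt_mem_nhds (by norm_num : (0:ℝ) < 1 / 4)))
  refine ⟨1, max n₁ 4, fun N hN σ hσ c => (hS N (by omega) σ hσ c).trans ?_⟩
  have hN4 : (4 : ℝ) ≤ N := by exact_mod_cast le_of_max_le_right hN
  have hNpos : (0 : ℝ) < N := by linarith
  have h1 : C * ((N : ℝ) * κ ^ N) < 1 / 4 := hn₁ N (le_of_max_le_left hN)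
  have h2 : C * κ ^ N ≤ 1 / (4 * N) := by
    rw [le_div_iff₀ (by linarith)]; nlinarith [mul_nonneg hC (pow_nonneg hκ0 N)]
  have h3 : 1 / 2 + C * κ ^ N ≤ 1 - 1 / (N : ℝ) ^ (1 : ℕ) := by
    rw [pow_one]
    have : 1 / (4 * (N : ℝ)) + 1 / N ≤ 1 / 2 := by
      rw [div_add_div _ _ (by linarith) (by linarith), div_le_iff₀ (by positivity)]; nlinarith
    linarith
  exact mul_le_mul_of_nonneg_right h3 (by positivity)

/-! ## 2. The pairs2 moment bound (statement; transfer matrix on the last two letters) -/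

/-- **(HC-P2-mgf) statement**: `E_{x odd} (4/5)^{pairs2 (J x)} ≤ C·κ^N`, i.e. `Σ_{x odd} (4/5)^{pairs2(J x)} ≤ C·κ^N·2^{N−1}`
(`(1/2)^{⌊(p−1)/3⌋} ≤ 2·(4/5)^p` converts LEMMA C's output).  Proof route: fibre bound `AffBells22.sum_odd_le_sum_hardCore`, then
fugacity-2 hard-core words with weight `4/5` per factor `0?0`: on the last-two-letters states `(E₁₁, E₁₀, E₀₁)` the step is
`E₁₁' = E₁₁ + E₀₁`, `E₁₀' = 2E₁₁ + (8/5)E₀₁`, `E₀₁' = E₁₀` (cf. `Literature.Probability.LatticeModels.HardCorePairs2.esum_succ_*`, signed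
case), and the positive row vector `u = (43, 20, 39)` is a super-solution `u·M ≤ (39/20)·u` (check: `43+40 = 83 ≤ 83.85`, `39 ≤ 39`,
`43 + 32 = 75 ≤ 76.05`), whence every partial sum is `≤ C·(39/20)^N` and `κ = 39/40`. -/
def KernelPairs2MGF : Prop :=
  open scoped Classical in
  ∃ κ : ℝ, 0 ≤ κ ∧ κ < 1 ∧ ∃ C : ℝ, ∀ N ≥ 3,
    ∑ x ∈ (univ.filter fun x : Fin N → Bool => Fib19.IsOdd x),
        (4 / 5 : ℝ) ^ AffBells26.pairs2 (Fib19.kline x) ≤ C * κ ^ N * (2 : ℝ) ^ (N - 1)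

/-- The super-solution certificate of (HC-P2-mgf) (PROVED arithmetic): `u·M ≤ (39/20)·u` for `u = (43, 20, 39)`, columnwise. -/
theorem pairs2MGF_certificate :
    (43 : ℚ) * 1 + 20 * 2 + 39 * 0 ≤ 39 / 20 * 43 ∧ (43 : ℚ) * 0 + 20 * 0 + 39 * 1 ≤ 39 / 20 * 20 ∧
      (43 : ℚ) * 1 + 20 * (8 / 5) + 39 * 0 ≤ 39 / 20 * 39 := by norm_num

/-! ## 3. The two finite contraction lemmas (PROVED, integer form)

Vectors `ZMod 3 → ℤ` are signed measures on the walk's state space; `vtx z` is TWICE the vertex coin block whose zero coefficient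
sits at shift `z` (i.e. `S^a + S^b`, `{a,b} = {0,1,2} ∖ {z}`), `tcoin a` is TWICE the twisted coin `I − S^a`, `refl r` the reflection
`I − 2E_r`, `orefl` an optional reflection.  Norms are `ℓ¹`. -/

/-- `ℓ¹` norm of an integer vector on `ℤ₃`. -/
def l1 (v : ZMod 3 → ℤ) : ℤ := |v 0| + |v 1| + |v 2|

/-- Basis vector. -/
def δ (h : ZMod 3) : ZMod 3 → ℤ := fun i => if i = h then 1 else 0

/-- Reflection `R_r = I − 2E_r` (the emission `diag((−1)^{[h = r]})` up to a global sign). -/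
def refl (r : ZMod 3) (v : ZMod 3 → ℤ) : ZMod 3 → ℤ := fun h => if h = r then -v h else v h

/-- Optional reflection (a silenced or absent emission block is `none`). -/
def orefl : Option (ZMod 3) → (ZMod 3 → ℤ) → ZMod 3 → ℤ
  | none, v => v
  | some r, v => refl r v

/-- Twice the vertex coin block with vanishing coefficient at shift `z`: `(S^a + S^b) v`, `{a, b} = univ ∖ {z}`, `(S^a v)(h) = v(h − a)`. -/
def vtx (z : ZMod 3) (v : ZMod 3 → ℤ) : ZMod 3 → ℤ := fun h => (v (h - 0) + v (h - 1) + v (h - 2)) - v (h - z)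

/-- Twice the twisted coin `I − S^a` (`a ∈ {1, 2}` the spine value at the coin). -/
def tcoin (a : ZMod 3) (v : ZMod 3 → ℤ) : ZMod 3 → ℤ := fun h => v h - v (h - a)

/-- **LEMMA C (vertex form, PROVED): three (vertex coin block, reflection) pairs halve the `ℓ¹` norm.**
`‖R_{r₃}Ṽ_{z₃}R_{r₂}Ṽ_{z₂}R_{r₁}Ṽ_{z₁} δ_h‖₁ ≤ 4 = ½·2³·‖δ_h‖₁`.  With the trilinear/convex extension of PROOF-STAIR §3 this gives
`‖R Q₃ R Q₂ R Q₁ m‖₁ ≤ ½‖m‖₁` for all coin blocks `Qᵢ` (circulant stochastic, coefficients `≤ ½`) and all signed `m`. -/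
theorem threePairContractionZ :
    ∀ h z₁ r₁ z₂ r₂ z₃ r₃ : ZMod 3, l1 (refl r₃ (vtx z₃ (refl r₂ (vtx z₂ (refl r₁ (vtx z₁ (δ h))))))) ≤ 4 := by
  decide

/-- Two pairs do NOT contract in general (tightness of LEMMA C): `z = 2` twice with reflections missing / hitting gives norm `4 = 1·2²`. -/
theorem twoPair_noContraction : l1 (refl 2 (vtx 2 (refl 2 (vtx 2 (δ 0))))) = 4 := by decide

/-- **LEMMA C⁻ (PROVED): from a mean-zero state, two twisted coins with arbitrary interleaved reflections contract `ℓ¹` by `3/4`.**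
`‖[R] T_b [R] T_a [R] (δ_i − δ_j)‖₁ ≤ 6 = ¾·2²·‖δ_i − δ_j‖₁` (`T = 2P⁻`; `a, b ∈ {1,2}`).  The extreme points of the mean-zero `ℓ¹` ball are
`±(δ_i − δ_j)/2` and twisted coins preserve mean zero, so by induction `|b₁(J)| ≤ (3/4)^{⌊(Z(J)−1)/2⌋} ≤ (4/3)(√3/2)^{Z(J)}`. -/
theorem twistedTwoCoinContractionZ :
    ∀ i j : ZMod 3, i ≠ j → ∀ (o₀ o₁ o₂ : Option (ZMod 3)) (a b : ZMod 3), a ≠ 0 → b ≠ 0 →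
      l1 (orefl o₂ (tcoin b (orefl o₁ (tcoin a (orefl o₀ (fun h => δ i h - δ j h)))))) ≤ 6 := by
  decide

/-- One twisted coin does not contract from a mean-zero state (tightness): `‖T_2 (δ_0 − δ_1)‖₁ = 4 = 1·2·‖δ_0 − δ_1‖₁`. -/
theorem twistedOneCoin_noContraction : l1 (tcoin 2 (fun h => δ 0 h - δ 1 h)) = 4 := by decide

/-- Generalised (shifted) twisted coin `S^s − S^t`, `s ≠ t` (`= S^s · 2P⁻_{t−s}`; absorbs the shifts of the emission blocks). -/
def gtw (s t : ZMod 3) (v : ZMod 3 → ℤ) : ZMod 3 → ℤ := fun h => v (h - s) - v (h - t)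

/-- LEMMA C⁻ with shifted twisted coins (PROVED, 3456 cases): `‖G₂ [R] G₁ [R] (δ_i − δ_j)‖₁ ≤ 6`. -/
theorem gtwTwoCoinContractionZ :
    ∀ i j : ZMod 3, i ≠ j → ∀ (o₀ o₁ : Option (ZMod 3)) (s₁ t₁ s₂ t₂ : ZMod 3), s₁ ≠ t₁ → s₂ ≠ t₂ →
      l1 (gtw s₂ t₂ (orefl o₁ (gtw s₁ t₁ (orefl o₀ (fun h => δ i h - δ j h))))) ≤ 6 := by
  decide


end AffBells33

end Summit.QuantumAdvantage.AdviceFreeQNC0
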